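import Mathlib
import HarnessLib
import HarnessLib.Audit
import Summits.CriticalPhenomena.Statement
import Literature.Probability.RandomPlanarGeometry.LatticeSlitIncrements
import Literature.Probability.RandomPlanarGeometry.LoewnerDescription
import Literature.Probability.RandomPlanarGeometry.SLEUniquenessInLaw
import Literature.Probability.RandomPlanarGeometry.CaratheodoryHalfPlaneProofs
import HarnessLib.Audit.Status.Attr

/-!
Route: SAWTipEnvironment

DORMANT since 2026-08-26T03:37:21Z (reconciler: no traction for 8.3 d (last activity statement-attached at 2026-08-17T19:21:11Z); parked, not closed — `ledger route dormant route-CriticalPhenomena-SAWTipEnvironment --off` to reactivate) — unstaffed, not closed; items shared with open routes are served there. `ledger route dormant <id> --off` reactivates.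

# Route SAWTipEnvironment — Brownian driving from ergodicity — the SAW driving function is a
martingale transform over its own tip environment; a Gordin corrector over Kesten's measure, kappa
an output pinned by restriction

It suffices to show X = MartingaleCorrector ∧ KestenMeasure ∧ CorrectorPassage ∧ KappaPin ∧
EventualTight (with the supports
LimitsDescribable, DrivingIdentification) — card ergodic-loewner-tip-environment-v2 made crux-first.
Read the critical SAW in (Ω_δ; a_δ, b_δ)
through a chordal uniformizer φ; its half-plane driving value ξ_η of the past η (tree:
LatticeSlit.drivingValue) is, by exact Loewner
concatenation, a martingale TRANSFORM over the walk's own environment chain (past seen from the tip,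
one-step kernel = exact SAW slit-kernel
p(u|η) = x_c Z_ηu(b)/Z_η(b)). KestenMeasure: the bulk environment of the chordal walk has a
stationary ergodic local limit μ (Kesten's two-sided
infinite SAW). MartingaleCorrector: over μ the Loewner drift has a Gordin corrector, i.e. on the
lattice there is an EXACT SAW-martingale M on
prefixes with |M − ξ| ≤ ε, jumps ≤ ε and predictable bracket within ε of κ·(capacity) for ONE κ ∈
(0,4) (κ = the Kipnis–Varadhan variance of μ, an
output). CorrectorPassage + DrivingIdentification: every subsequential limit is then the SLE_κ law
(Lévy); KappaPin: lattice-exact restriction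
forces κ = 8/3; EventualTight + LimitsDescribable are the shared precompactness inputs.
Lean: `MartingaleCorrector ∧ KestenMeasure ∧ CorrectorPassage ∧ KappaPin ∧ EventualTight ∧
LimitsDescribable ∧ DrivingIdentification`

## Assembly
Self-contained over Literature, CHECKED sorry-free (deciding theorem `closes`, h21_check_closes ok):
fix (D; a, b) with an endpoint approximation;
x_c > 0 (straight walks) and finiteness of Ω_δ make SAW.law a probability measure for small δ, so
EventualTight feeds the Prokhorov criterion
SLEUniquenessInLaw.convergesInLawToSLE_of_isTightAlongMesh' (via a surrogate probability family
along the germ at 0⁺), and it remains to identify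
every probability subsequential limit ν;
MarkedDomain.exists_isChordalUniformizing_holds gives φ; LimitsDescribable gives a.e.
describability; MartingaleCorrector (fed KestenMeasure) gives
κ ∈ (0,4) and the corrector property at (D, a, b, φ); CorrectorPassage gives the cylinder
identities; DrivingIdentification gives IsSLELaw κ D ν;
KappaPin gives κ = 8/3. Every item is used by the deciding theorem `closes`.

Rationale: WHY THIS LINE. Schramm's principle run backwards: keep the exact domain Markov property of the
lattice SAW and replace conformal invariance by STATIONARITY of
the walk seen from its tip plus ONE rate — the environment-seen-from-the-particle CLT
(KipnisVaradhan1986; Gordin 1969; Maxwell–Woodroofe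
doi:10.1214/aop/1019160258; Peligrad–Utev doi:10.1214/009117904000001035) transplanted from
particles in random media to the Loewner encoding:
particle ↦ tip, environment ↦ the walk's own infinite past under Kesten's measure (Kesten1963SAW;
LawlerSchrammWerner2004SAW §3.4: Q 'not known
to exist, although it is believed to'), additive functional ↦ driving increment (Kennedy2008Driving
§3: U_t = Σ ΔU_i, t = Σ Δt_i), corrector
u = Σ P^k b ↦ the lattice martingale M of MartingaleCorrector, CLT variance ↦ κ_eff. No observable
is posited (the class of exact Z² stencils is
provably empty, NienhuisWeightsExcludeVertexSAW), no rigidity axiom, no coupling: Brownian driving —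
hence conformal invariance — is OUTPUT, and
κ is pinned afterwards by the lattice-exact restriction identity
(LawlerSchrammWerner2003Restriction). Kennedy's distorted-lattice numerics
(Kennedy2008Driving §2; Kennedy2004) are the empirical shadow: under a shear the marginals stay
Gaussian while increments correlate — exactly
the Maxwell–Woodroofe borderline ‖E[S_n|F_0]‖ ≍ n^(1/2) where the CLT fails. None of the 56 open
routes carries a tip-environment chain, a
Loewner additive functional or an ergodic CLT (nearest: SAWZoomRigidity = ergodicity over SCALES of
limit sets; SAWSteinDefect = generator
comparison against ASSUMED SLE_(8/3) value functions; SAWLaplacianWalk / SAWSchrammPassage =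
explicit martingale OBSERVABLES with identified
limits; SAWStochasticQuantisation = BFACF dynamics); the negatives index is untouched (eventual
tightness stmt-1881, not the refuted stmt-0772).

RANKED CRUXES. #2 MartingaleCorrector (crux) — (card K1+K4 in chordal, typed form; deps
KestenMeasure) given Kesten's measure there is ONE κ ∈ (0,4) such that for every Dobrushin domain,
endpoint approximation, chordal uniformizer φ, horizon T and ε > 0, for all small δ there is a
function M of the lattice prefix that is an EXACT martingale for the SAW tip kernel p(u|η) =
x_c·Z_ηu(b_δ)/Z_η(b_δ) (slit partition functions to the target) up to capacity time T, and with
SAW.law-probability ≥ 1 − ε simultaneously for all prefixes η of capacity ≤ T: |M(η) − ξ_η| ≤ ε (ξ_η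
= LatticeSlit.drivingValue φ η), the predictable bracket Σ_k Σ_u p(u|η_k)(M(η_k u) − M(η_k))² is
within ε of κ·capTime(η), and the jumps of M are ≤ ε. Content: M = ξ + Gordin corrector of the
Loewner drift b(E) = Σ_s p(s|E) dW(E,s) over the stationary tip-environment chain; its existence
with homogenised bracket is the tip-balance rate (TB) ‖Σ_(k<n) E_μ[b(E_k)|F_0]‖_2 = O(n^(1/2−ε₀))
plus in-octave homogenisation of the conditional variance, transferred to bulk tips of the chordal
walk. [deps: KestenMeasure] [difficulty: open-problem] (why it might fail: here conformal covariance
lives: a sheared embedding satisfies all else and sits ON the Maxwell–Woodroofe borderline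
‖E[S_n|F_0]‖₂ ≍ n^(1/2); no rate is known for ANY SAW tip response (pattern theorem is rate-free);
scale ratios ρ at fjord-trapped tips may spoil moments.) [KipnisVaradhan1986,
doi:10.1214/aop/1019160258, doi:10.1214/009117904000001035, Kennedy2008Driving,
LawlerSchrammWerner2004SAW, Beffara2008Universal]
#3 KestenMeasure (crux) — (card K2, bulk form) Kesten's two-sided infinite SAW exists as the BULK
LOCAL LIMIT of the critical chordal SAW: there is a probability measure μ on bi-infinite
nearest-neighbour self-avoiding paths ω : ℤ → ℤ² with ω 0 = 0, ergodic under the re-rooting shift ω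
↦ ω(·+1) − ω 1, such that for every Dobrushin domain, endpoint approximation, continuous compactly
supported bump g ≥ 0 inside D (g ≢ 0), radius r and pattern q, the g(δ·)-weighted frequency, under
SAW.law, of vertices of the walk whose centred (2r)-window equals q (centred) converges as δ → 0⁺ to
μ(window = q). [difficulty: open-problem] (why it might fail: the planar two-sided infinite SAW is
open since Kesten 1963 (LSW04 §3.4: 'Q(ω) is not known to exist'; only the half-plane walk exists,
LSW04 App.); the x_c-domain walk could have boundary- or approximation-dependent bulk statistics (no
ratio-limit theorem with rates in d=2).) [Kesten1963SAW, LawlerSchrammWerner2004SAW,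
MadrasSlade1993, arXiv:1802.06667]
#4 CorrectorPassage (crux) — (passage to the limit, card P2 read against weak limits) fix κ > 0, a
Dobrushin domain, endpoint approximation and chordal uniformizer φ; if the corrector property of
MartingaleCorrector holds at (D, a, b, φ, κ) for all T, ε, then for every probability subsequential
limit law ν of the SAW curve laws that is ν-a.e. Loewner-describable from a, the driving function W
= drivingFunction φ satisfies the cylinder martingale identities E_ν[(W_(t∧τ_m) −
W_(s∧τ_m))·ψ(W_(s_1),…,W_(s_n))] = 0 and E_ν[((W² − κ·)_(t∧τ_m) − (W² − κ·)_(s∧τ_m))·ψ(…)] = 0 for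
all m, s ≤ t, s_i ≤ s and continuous |ψ| ≤ 1, where τ_m = inf(t : |W_t| ≥ m) ∧ m. [deps:
MartingaleCorrector] [difficulty: XL] (why it might fail: weak convergence of curves does not carry
lattice driving values ξ_η to the limit's drivingFunction without KS-type uniform control (KS17 Thm
1.5(iii) needs Condition G2, not just tightness + describability); uniform integrability of M² up to
τ_m and clock matching may fail on atypical pasts.) [KemppainenSmirnov2017, CDHKSCRAS2014,
Kennedy2008Driving, Lawler2005]
#5 KappaPin (crux) — (card P3 as a crux: κ is an output, pinned by restriction) for every Dobrushin
domain and endpoint approximation, a probability subsequential limit law ν of the critical SAW curve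
laws that is a chordal SLE_κ law in (D; a, b) for some κ > 0 has κ = 8/3 — the lattice-exact
two-sided restriction identity passes to ν and chordal SLE_κ has the restriction property iff κ =
8/3 (LSW03). [difficulty: L] (why it might fail: the restriction identity passes to the limit only
with null boundary-touching of ν on smooth subdomains and a portmanteau argument on closed range
events (cf. AxiomsOfLimit stmt-1370); an approximation-dependent κ would already refute the conjunct
as typed.) [LawlerSchrammWerner2003Restriction, LawlerSchrammWerner2004SAW, KennedyLawler2013]
#6 EventualTight (crux) — (shared verbatim with stmt-CriticalPhenomena-1881, routes SAWLaplacianWalk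
/ SAWParafermion) eventual tightness of the critical SAW curve laws along the mesh, IsTightAlongMesh
form, for every Dobrushin domain and endpoint approximation. [difficulty: open-problem] (why it
might fail: no annulus-crossing / Aizenman–Burchard bound for the x_c-SAW is in print (KS17 §4 omits
SAW; G2 even fails for UST); sub-ballisticity is the strongest known input; boundary approach of the
critical SAW is uncontrolled.) [KemppainenSmirnov2017, DuminilCopinHammond2013, arXiv:2310.17299,
LawlerSchrammWerner2004SAW]
#9 LimitsDescribable (support) — (shared verbatim with stmt-CriticalPhenomena-4481, route
SAWLaplacianWalk) every probability subsequential limit law of the SAW curve laws is carried by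
curve classes starting at a that are Loewner-describable through the chordal uniformizer φ (KS17 Thm
1.5 (ii) / Cor 1.7 in output form). [difficulty: open-problem] [KemppainenSmirnov2017,
LawlerSchrammWerner2004SAW]
#9 DrivingIdentification (support) — (pure stochastic calculus, provable now from the tree) for κ ∈
(0,4), a chordal uniformizer φ of (D; a, b) and a probability law ν on curve classes, ν-a.e.
Loewner-describable from a: the cylinder martingale identities of CorrectorPassage for W =
drivingFunction φ and W² − κt (stopped at τ_m, all m) imply that ν is the chordal SLE_κ law —
monotone class ⇒ W^(τ_m), (W² − κ·)^(τ_m) martingales for the natural filtration; τ_m ↑ ∞ by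
continuity; W_0 = 0 from source = a; then isSLELaw_of_isLocalMartingale_driving_of_lt_four (Lévy
characterisation, measurable_drivingFunction_apply, isLoewnerDescribed_drivingFunction).
[difficulty: M] [CDHKSCRAS2014, Lawler2005, KemppainenSmirnov2017]

TWO-LAYER PLAN. Foreseen glued splits (k ≤ 3, depth 1), filed only when a crux closes or stalls with
a census: MartingaleCorrector ⇐ TipBalanceRate (whole-plane
(TB): under Kesten's measure, in the tip-normalised uniformiser of ℂ minus the infinite past,
‖Σ_(k<n) E_μ[b(E_k)|F_0]‖_2 = O(n^(1/2−ε₀)) for the odd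
Loewner drift b, plus the same power-rate averaging for the conditional-variance and clock
functionals v, τ) → ChordalTransfer (local equilibrium
of bulk tips of the chordal walk in D_δ and vanishing, in the hydrodynamic frame, of the
boundary/target-induced conditional drift) →
MWTransformCLT (pure probability: martingale-transform approximation with multiplicatively
predictable scales c_k, Peligrad–Utev) →
MartingaleCorrector; TipBalanceRate is filed at open as an informal item (needs definition D2).
KestenMeasure ⇐ HalfPlaneToPlane (two-sided
measure from Kesten's half-plane measure + bridge decoupling) → BulkEquilibrium (domain walk vs
whole-plane walk at bulk vertices) → KestenMeasure.
CorrectorPassage ⇐ DrivingValuesConverge (KS Thm 1.5 (iii) form for the SAW) → UniformIntegrability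
→ CorrectorPassage.

KILL CRITERIA. ¬KestenMeasure in the strong sense (two different bulk local limits along two
subsequences / two domains) kills the stationarity input — close
refuted:KestenMeasure (and record it as a barrier for every tip-kernel route: LaplacianWalk,
TurnDefect, SteinDefect). A proof that the chordal
(TB) plateau persists on ℤ² (past–future Loewner cross-correlation NOT decaying in the lattice data,
as it does not under a shear) refutes
MartingaleCorrector — close refuted:MartingaleCorrector. ¬CorrectorPassage by a describability/UI
counterexample ⇒ restate with KS Condition G2
as hypothesis (pivot to the shared KSConditionG2 item once its typing is repaired). KappaPin refuted
⇒ the conjunct itself is false as typed.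
SAWScalingLimit proved elsewhere moots everything; EventualTight is shared and its fate is common to
all SAW routes.

NOT DECOMPOSED YET. The whole-plane objects (tip-normalised slit uniformiser φ_E ~ i√z, step data
(dW, dt, ρ), the drift b, conditional variance v, clock τ, the
projective norm) — definition requests D1/D2 below; the Maxwell–Woodroofe summability Σ n^(−3/2)‖S_n
b‖ < ∞ versus a plain power rate; the winding
lemma killing the D4 heading channel (|E[sin 4θ_1(k)|F_0]| ≤ e^(−8 Var_k), card P5) — a layer-2
lemma of TipBalanceRate; the LERW calibration
theorem (card P4: (TB) holds for the two-sided LERW of arXiv:1802.06667 and FAILS under a shear) — a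
Literature-level deliverable, not an item;
moment control of ρ at fjord-trapped tips.

CHEAPEST FALSIFIER. PAST–FUTURE LOEWNER CROSS-CORRELATION AT EQUAL SCALES (card falsifier; kit jobs
j003440/j003441 of the card's author, results not readable from
this seat): sample long SAWs (pivot) and LERWs on ℤ², uniformise ℂ minus (ray + n-step past), and
measure corr(past driving lean, normalised
n-step future driving displacement) for n = 8…64: the line predicts power-law DECAY on ℤ² for both
SAW and LERW (LERW = calibration, SLE_2 is a
theorem) and an n-independent PLATEAU for the same walks read through diag(1.25, 0.8) or a
0.3-shear. No decay on ℤ² kills MartingaleCorrector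
cheaply. Next cheapest (lookup, done 2026-08-16): is a two-sided planar infinite SAW or a rate for
Kesten's pattern theorem in print? — no
(LSW04 §3.4 p.14 read; MadrasSlade1993; searches below).

NUMBERS. κ_eff must come out 8/3 (restriction exponent 5/8, LawlerSchrammWerner2003Restriction);
Kennedy2004 / Kennedy2008Driving: SAW driving
process on ℤ² Gaussian with variance-rate 8/3 within Monte-Carlo error, distorted models (λ = 0.9,
0.95) Gaussian marginals but dependent
increments; Maxwell–Woodroofe threshold: Σ_n n^(−3/2)‖E[S_n|F_0]‖_2 < ∞ (any power saving n^(1/2−ε₀)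
suffices; the borderline n^(1/2) fails);
capacity of n SAW steps at mesh δ ≍ (n^(3/4)δ)², so a fixed capacity window holds ≍ δ^(−4/3) steps.
Items at open: 8 (5 cruxes, 2 supports,
1 assembly), 2 shared (stmt-1881, stmt-4481); 1 informal crux (TipBalanceRate) filed after open.

DEFINITION REQUESTS. D1 `KestenTwoSidedSAW` (topic Literature/Probability/RandomPlanarGeometry):
structure = probability law on bi-infinite simple lattice paths
rooted at 0, shift-stationary and ergodic, with the one-step continuation kernel; existence is the
SEPARATE statement KestenMeasure. D2
`TipNormalisedUniformizer` / `loewnerDrift`: the conformal map of ℂ minus an infinite polygonal slit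
onto ℍ, tip ↦ 0, ∞ ↦ ∞, normalised
φ_E(z)·(z/u)^(−1/2) → i at the tip (u = last step direction); step data dW(E,s), dt(E,s), ρ(E,s);
the drift b(E) = Σ_s p(s|E) dW(E,s) and the
projective norm ‖Σ_(k<n) P^k b‖_(L²(μ)) — needed to type TipBalanceRate. Both filed after open with
`ledger workitem add --kind definition`.

Novelty: Searches (2026-08-16, this seat; searchd local FTS reset by peer once, OpenAlex/S2 rate-limited —
logged in NOTES.md): `lit search --hybrid
"driving process self-avoiding walk Brownian motion kappa 8/3 numerical"` (10 held docs: Lawler2005,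
Lawler 1991/2012, MadrasSlade1993, Böttcher–
Herrmann — none with an environment process); `lit search --source arxiv "self-avoiding walk Loewner
driving function"` (1: arXiv:1202.1658,
sandpile SLE_2); `lit search --source zbmath "self-avoiding walk driving process Loewner"` (0); `lit
search --source arxiv "infinite self-avoiding
walk two-sided Kesten measure local limit"` (0); `lit galaxy search "driving function of the
self-avoiding walk" --star all` (0); `lit galaxy
search "Kipnis-Varadhan" --star pdf` (12: RWRE / interacting particles / homogenisation —
Rassoul-Agha, Bolthausen–Sznitman, Sznitman–Zeitouni,
Kumagai — none on Loewner encodings); `lit galaxy search "Loewner" --author-contains Kennedy --star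
all` (13, none relevant beyond Smirnov ICM);
LSW04 READ (arXiv:math/0204277 p.14 'Q(ω) is not known to exist', Appendix: half-space walk exists);
plus the card's own logged searches
(galaxy bm25 'Kipnis-Varadhan … Loewner driving … martingale approximation' 12 rows none; Kennedy
math/0702071 pp.4-5 read) and the critic's
(openalex/galaxy, 2026-08-16T00:15Z). All 56 open route files' mechanisms and the 155 idea cards of
the sub were scanned (levers listed in
NOTES.md): no tip-environment chain, Loewner additive functional or ergodic CL  [refs: 10.1214/aop/1019160258, 10.1214/009117904000001035, 1202.1658, math/0204277, math/0702071, doi:10.1214/aop/1019160258, doi:10.1214/009117904000001035, Lawler2005, MadrasSlade1993, KipnisVaradhan1986]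

Barriers (technique_class: ergodic-homogenisation, martingale-approximation): - technique_class: ergodic-homogenisation, martingale-approximation, tip-environment
- Literature.Barriers.CriticalPhenomena.NienhuisWeightsExcludeVertexSAW: evaded — no exact local
linear relation / stencil for a ℤ² observable is posited (that class is provably empty,
not_hasExactVertexRelationZ2); the martingale M is Gordin's corrector, which exists iff a
summability property of the environment chain holds.
- Literature.Barriers.CriticalPhenomena.ParafermionicHalfCauchyRiemann: evaded — nothing is
reconstructed from boundary values, no half-Cauchy–Riemann relation, no Morera step; hexagonal
objects do not enter.
- Literature.Barriers.CriticalPhenomena.EmbeddingModulusUniqueness: evaded by construction and USED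
as calibration — ξ_η lives in the Euclidean conformal maps φ, the corrector property is
embedding-sensitive and is predicted to FAIL (borderline n^(1/2)) for the same combinatorial walks
under a shear (Kennedy2008Driving §2), which is how the quarter-turn enters.
- Literature.Barriers.CriticalPhenomena.SAWNotKineticallyGrown: the tip kernel p(u|η) is the exact
conditional kernel of ONE configurational measure (slit partition-function ratio, SlitFirstStep
stmt-4484 proved), not a consistent family of uniform measures nor a local growth rule; conceded:
existence of the stationary planar environment IS KestenMeasure (open, as the barrier file records).
- Literature.Barriers.CriticalPhenomena.ScaleCovarianceNotMoebius: not met — no symmetry upgrade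
from Euclidean + scale

History (route lifecycle, newest last):
- 2026-08-26T03:37:21Z · DORMANT — reconciler: no traction for 8.3 d (last activity statement-attached at 2026-08-17T19:21:11Z); parked, not closed — `ledger route dormant route-CriticalPhenomena (operator:999:2318707)

sub-problem: SAWScalingLimit · status: dormant · opened planner-plan-novel-CriticalPhenomena-SAWScaling-8a38611a-v2-g4-0 2026-08-16T17:39:02Z · rev 4 · ledger route-CriticalPhenomena-SAWTipEnvironment
GENERATED by the gate from the ledger (D-0016/17). Provers cite these decls: `theorem foo : Summit.CriticalPhenomena.SAWScalingLimit.Theses.SAWTipEnvironment.<Decl> := …` in Summits/CriticalPhenomena/SAWScalingLimit/Theorems/<Name>.lean.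
-/

namespace Summit.CriticalPhenomena.SAWScalingLimit.Theses.SAWTipEnvironment

open scoped BigOperators Topology Manifold Classical MeasureTheory ProbabilityTheory Matrix InnerProductSpace ComplexConjugate ContinuousMap
open Filter Set Function TopologicalSpace MeasureTheory

attribute [summit_statement] _root_.SAWScalingLimit

/-- item stmt-CriticalPhenomena-16037 · crux · rank 2 · open · by planner
why it might fail: here conformal covariance lives: a sheared embedding satisfies all else and sits ON the Maxwell–Woodroofe borderline ‖E[S_n|F_0]‖₂ ≍ n^(1/2); no rate is known for ANY SAW tip response (pattern theorem is rate-free); scale ratios ρ at fjord-trapped tips may spoil moments.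
sources: KipnisVaradhan1986, doi:10.1214/aop/1019160258, doi:10.1214/009117904000001035, Kennedy2008Driving, LawlerSchrammWerner2004SAW, Beffara2008Universal
[crux] (card K1+K4 in chordal, typed form; deps KestenMeasure) given Kesten's measure there is ONE κ
∈ (0,4) such that for every Dobrushin domain, endpoint approximation, chordal uniformizer φ, horizon
T and ε > 0, for all small δ there is a function M of the lattice prefix that is an EXACT martingale
for the SAW tip kernel p(u|η) = x_c·Z_ηu(b_δ)/Z_η(b_δ) (slit partition functions to the target) up
to capacity time T, and with SAW.law-probability ≥ 1 − ε simultaneously for all prefixes η of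
capacity ≤ T: |M(η) − ξ_η| ≤ ε (ξ_η = LatticeSlit.drivingValue φ η), the predictable bracket Σ_k Σ_u
p(u|η_k)(M(η_k u) − M(η_k))² is within ε of κ·capTime(η), and the jumps of M are ≤ ε. Content: M = ξ
+ Gordin corrector of the Loewner drift b(E) = Σ_s p(s|E) dW(E,s) over the stationary
tip-environment chain; its existence with homogenised bracket is the tip-balance rate (TB) ‖Σ_(k<n)
E_μ[b(E_k)|F_0]‖_2 = O(n^(1/2−ε₀)) plus in-octave homogenisation of the conditional variance,
transferred to bulk tips of the chordal walk. [deps: KestenMeasure] [difficulty: open-problem] -/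
@[route_item "route-CriticalPhenomena-SAWTipEnvironment", crux]
def MartingaleCorrector : Prop :=
  (∃ μ : MeasureTheory.Measure (ℤ → Literature.Probability.LatticeModels.Site 2), MeasureTheory.IsProbabilityMeasure μ ∧ (∀ᵐ ω ∂μ, ω 0 = 0 ∧ Function.Injective ω ∧ ∀ k : ℤ, (Literature.Probability.LatticeModels.zdGraph 2).Adj (ω k) (ω (k + 1))) ∧ Ergodic (fun (ω : ℤ → Literature.Probability.LatticeModels.Site 2) (k : ℤ) => ω (k + 1) - ω 1) μ ∧ ∀ (D : Literature.Probability.RandomPlanarGeometry.DobrushinDomain) (a b : ℝ → Literature.Probability.LatticeModels.Site 2), Literature.Probability.RandomPlanarGeometry.SAW.IsEndpointApprox D a b → ∀ (g : ℂ → ℝ), Continuous g → HasCompactSupport g → tsupport g ⊆ D.carrier → (∀ z, 0 ≤ g z) → (∃ z, 0 < g z) → ∀ (r : ℕ) (q : ℕ → Literature.Probability.LatticeModels.Site 2), Filter.Tendsto (fun δ : ℝ => (∫ γ, (∑ m ∈ Finset.range (γ.length + 1 - 2 * r), if (∀ j ≤ 2 * r, γ.walk.getVert (m + j) - γ.walk.getVert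 (m + r) = q j - q r) then g (Literature.Probability.LatticeModels.meshPoint δ (γ.walk.getVert (m + r))) else 0) ∂(Literature.Probability.RandomPlanarGeometry.SAW.law D.carrier δ (a δ) (b δ))) / (∫ γ, (∑ m ∈ Finset.range (γ.length + 1 - 2 * r), g (Literature.Probability.LatticeModels.meshPoint δ (γ.walk.getVert (m + r)))) ∂(Literature.Probability.RandomPlanarGeometry.SAW.law D.carrier δ (a δ) (b δ)))) (nhdsWithin 0 (Set.Ioi 0)) (nhds (μ {ω | ∀ j ≤ 2 * r, ω ((j : ℤ) - r) = q j - q r}).toReal)) → ∃ κ : NNReal, 0 < κ ∧ κ < 4 ∧ ∀ (D : Literature.Probability.RandomPlanarGeometry.DobrushinDomain) (a b : ℝ → Literature.Probability.LatticeModels.Site 2), Literature.Probability.RandomPlanarGeometry.SAW.IsEndpointApprox D a b → ∀ (φ : Literature.Probability.RandomPlanarGeometry.ConformalEquiv UpperHalfPlane.upperHalfPlaneSet D.carrier), D.IsChordalUniformizing φ → ∀ (T ε : ℝ), 0 < T → 0 < ε → ∀ᶠ δ in nhdsWithin 0 (Set.Ioi 0), let Z : Literature.Probability.LatticeModels.Site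 2 → List (Literature.Probability.LatticeModels.Site 2) → ℝ := fun w S => ∑' ω : Literature.Probability.RandomPlanarGeometry.SAW.DomainSAW D.carrier δ w (b δ), if ∀ v ∈ ω.walk.support.tail, v ∉ S then Literature.Probability.RandomPlanarGeometry.SAW.criticalFugacity ^ ω.length else 0; let p : List (Literature.Probability.LatticeModels.Site 2) → Literature.Probability.LatticeModels.Site 2 → Literature.Probability.LatticeModels.Site 2 → ℝ := fun S w u => Literature.Probability.RandomPlanarGeometry.SAW.criticalFugacity * Z u (S ++ [u]) / Z w S; ∃ M : List (Literature.Probability.LatticeModels.Site 2) → ℝ, (∀ (γ : Literature.Probability.RandomPlanarGeometry.SAW.DomainSAW D.carrier δ (a δ) (b δ)) (n : ℕ), n < γ.length → Literature.Probability.RandomPlanarGeometry.LatticeSlit.capTime φ (γ.walk.take n) ≤ T → M (γ.walk.take n).support = ∑ᶠ u ∈ {u | (Literature.Probability.LatticeModels.discreteDomainGraph D.carrier δ).Adj (γ.walk.getVert n) u ∧ u ∉ (γ.walk.take n).support}, p (γ.walk.take n).support (γ.walk.getVert n) u * M ((γ.walk.take n).support ++ [u])) ∧ Literature.Probability.RandomPlanarGeometry.SAW.law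 D.carrier δ (a δ) (b δ) {γ | ∃ n : ℕ, n ≤ γ.length ∧ Literature.Probability.RandomPlanarGeometry.LatticeSlit.capTime φ (γ.walk.take n) ≤ T ∧ (ε < |M (γ.walk.take n).support - Literature.Probability.RandomPlanarGeometry.LatticeSlit.drivingValue φ (γ.walk.take n)| ∨ ε < |(∑ k ∈ Finset.range n, ∑ᶠ u ∈ {u | (Literature.Probability.LatticeModels.discreteDomainGraph D.carrier δ).Adj (γ.walk.getVert k) u ∧ u ∉ (γ.walk.take k).support}, p (γ.walk.take k).support (γ.walk.getVert k) u * (M ((γ.walk.take k).support ++ [u]) - M (γ.walk.take k).support) ^ 2) - (κ : ℝ) * Literature.Probability.RandomPlanarGeometry.LatticeSlit.capTime φ (γ.walk.take n)| ∨ (n < γ.length ∧ ε < |M (γ.walk.take (n + 1)).support - M (γ.walk.take n).support|))} ≤ ENNReal.ofReal ε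

/-- item stmt-CriticalPhenomena-16038 · crux · rank 3 · open · by planner
why it might fail: the planar two-sided infinite SAW is open since Kesten 1963 (LSW04 §3.4: 'Q(ω) is not known to exist'; only the half-plane walk exists, LSW04 App.); the x_c-domain walk could have boundary- or approximation-dependent bulk statistics (no ratio-limit theorem with rates in d=2).
sources: Kesten1963SAW, LawlerSchrammWerner2004SAW, MadrasSlade1993, arXiv:1802.06667
[crux] (card K2, bulk form) Kesten's two-sided infinite SAW exists as the BULK LOCAL LIMIT of the
critical chordal SAW: there is a probability measure μ on bi-infinite nearest-neighbour
self-avoiding paths ω : ℤ → ℤ² with ω 0 = 0, ergodic under the re-rooting shift ω ↦ ω(·+1) − ω 1,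
such that for every Dobrushin domain, endpoint approximation, continuous compactly supported bump g
≥ 0 inside D (g ≢ 0), radius r and pattern q, the g(δ·)-weighted frequency, under SAW.law, of
vertices of the walk whose centred (2r)-window equals q (centred) converges as δ → 0⁺ to μ(window =
q). [difficulty: open-problem] -/
@[route_item "route-CriticalPhenomena-SAWTipEnvironment", crux]
def KestenMeasure : Prop :=
  ∃ μ : MeasureTheory.Measure (ℤ → Literature.Probability.LatticeModels.Site 2), MeasureTheory.IsProbabilityMeasure μ ∧ (∀ᵐ ω ∂μ, ω 0 = 0 ∧ Function.Injective ω ∧ ∀ k : ℤ, (Literature.Probability.LatticeModels.zdGraph 2).Adj (ω k) (ω (k + 1))) ∧ Ergodic (fun (ω : ℤ → Literature.Probability.LatticeModels.Site 2) (k : ℤ) => ω (k + 1) - ω 1) μ ∧ ∀ (D : Literature.Probability.RandomPlanarGeometry.DobrushinDomain) (a b : ℝ → Literature.Probability.LatticeModels.Site 2), Literature.Probability.RandomPlanarGeometry.SAW.IsEndpointApprox D a b → ∀ (g : ℂ → ℝ), Continuous g → HasCompactSupport g → tsupport g ⊆ D.carrier → (∀ z, 0 ≤ g z) → (∃ z,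 0 < g z) → ∀ (r : ℕ) (q : ℕ → Literature.Probability.LatticeModels.Site 2), Filter.Tendsto (fun δ : ℝ => (∫ γ, (∑ m ∈ Finset.range (γ.length + 1 - 2 * r), if (∀ j ≤ 2 * r, γ.walk.getVert (m + j) - γ.walk.getVert (m + r) = q j - q r) then g (Literature.Probability.LatticeModels.meshPoint δ (γ.walk.getVert (m + r))) else 0) ∂(Literature.Probability.RandomPlanarGeometry.SAW.law D.carrier δ (a δ) (b δ))) / (∫ γ, (∑ m ∈ Finset.range (γ.length + 1 - 2 * r), g (Literature.Probability.LatticeModels.meshPoint δ (γ.walk.getVert (m + r)))) ∂(Literature.Probability.RandomPlanarGeometry.SAW.law D.carrier δ (a δ) (b δ)))) (nhdsWithin 0 (Set.Ioi 0)) (nhds (μ {ω | ∀ j ≤ 2 * r, ω ((j : ℤ) - r) = q j - q r}).toReal)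

/-- item stmt-CriticalPhenomena-16039 · crux · rank 4 · open · by planner
why it might fail: weak convergence of curves does not carry lattice driving values ξ_η to the limit's drivingFunction without KS-type uniform control (KS17 Thm 1.5(iii) needs Condition G2, not just tightness + describability); uniform integrability of M² up to τ_m and clock matching may fail on atypical pasts.
sources: KemppainenSmirnov2017, CDHKSCRAS2014, Kennedy2008Driving, Lawler2005
[crux] (passage to the limit, card P2 read against weak limits) fix κ > 0, a Dobrushin domain,
endpoint approximation and chordal uniformizer φ; if the corrector property of MartingaleCorrector
holds at (D, a, b, φ, κ) for all T, ε, then for every probability subsequential limit law ν of the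
SAW curve laws that is ν-a.e. Loewner-describable from a, the driving function W = drivingFunction φ
satisfies the cylinder martingale identities E_ν[(W_(t∧τ_m) − W_(s∧τ_m))·ψ(W_(s_1),…,W_(s_n))] = 0
and E_ν[((W² − κ·)_(t∧τ_m) − (W² − κ·)_(s∧τ_m))·ψ(…)] = 0 for all m, s ≤ t, s_i ≤ s and continuous
|ψ| ≤ 1, where τ_m = inf(t : |W_t| ≥ m) ∧ m. [deps: MartingaleCorrector] [difficulty: XL] -/
@[route_item "route-CriticalPhenomena-SAWTipEnvironment", crux]
def CorrectorPassage : Prop :=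
  ∀ (κ : NNReal) (D : Literature.Probability.RandomPlanarGeometry.DobrushinDomain) (a b : ℝ → Literature.Probability.LatticeModels.Site 2) (φ : Literature.Probability.RandomPlanarGeometry.ConformalEquiv UpperHalfPlane.upperHalfPlaneSet D.carrier), 0 < κ → Literature.Probability.RandomPlanarGeometry.SAW.IsEndpointApprox D a b → D.IsChordalUniformizing φ → (∀ (T ε : ℝ), 0 < T → 0 < ε → ∀ᶠ δ in nhdsWithin 0 (Set.Ioi 0), let Z : Literature.Probability.LatticeModels.Site 2 → List (Literature.Probability.LatticeModels.Site 2) → ℝ := fun w S => ∑' ω : Literature.Probability.RandomPlanarGeometry.SAW.DomainSAW D.carrier δ w (b δ), if ∀ v ∈ ω.walk.support.tail, v ∉ S then Literature.Probability.RandomPlanarGeometry.SAW.criticalFugacity ^ ω.length else 0; let p : List (Literature.Probability.LatticeModels.Site 2) → Literature.Probability.LatticeModels.Site 2 → Literature.Probability.LatticeModels.Site 2 → ℝ := fun S w u => Literature.Probability.RandomPlanarGeometry.SAW.criticalFugacity * Z u (S ++ [u]) / Z w S; ∃ M : List (Literature.Probability.LatticeModels.Site 2) → ℝ, (∀ (γ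 : Literature.Probability.RandomPlanarGeometry.SAW.DomainSAW D.carrier δ (a δ) (b δ)) (n : ℕ), n < γ.length → Literature.Probability.RandomPlanarGeometry.LatticeSlit.capTime φ (γ.walk.take n) ≤ T → M (γ.walk.take n).support = ∑ᶠ u ∈ {u | (Literature.Probability.LatticeModels.discreteDomainGraph D.carrier δ).Adj (γ.walk.getVert n) u ∧ u ∉ (γ.walk.take n).support}, p (γ.walk.take n).support (γ.walk.getVert n) u * M ((γ.walk.take n).support ++ [u])) ∧ Literature.Probability.RandomPlanarGeometry.SAW.law D.carrier δ (a δ) (b δ) {γ | ∃ n : ℕ, n ≤ γ.length ∧ Literature.Probability.RandomPlanarGeometry.LatticeSlit.capTime φ (γ.walk.take n) ≤ T ∧ (ε < |M (γ.walk.take n).support - Literature.Probability.RandomPlanarGeometry.LatticeSlit.drivingValue φ (γ.walk.take n)| ∨ ε < |(∑ k ∈ Finset.range n, ∑ᶠ u ∈ {u | (Literature.Probability.LatticeModels.discreteDomainGraph D.carrier δ).Adj (γ.walk.getVert k) u ∧ u ∉ (γ.walk.take k).support}, p (γ.walk.take k).support (γ.walk.getVert k) u * (M ((γ.walk.take k).support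 ++ [u]) - M (γ.walk.take k).support) ^ 2) - (κ : ℝ) * Literature.Probability.RandomPlanarGeometry.LatticeSlit.capTime φ (γ.walk.take n)| ∨ (n < γ.length ∧ ε < |M (γ.walk.take (n + 1)).support - M (γ.walk.take n).support|))} ≤ ENNReal.ofReal ε) → ∀ ν : MeasureTheory.Measure (Literature.Probability.RandomPlanarGeometry.CurveClass ℂ), MeasureTheory.IsProbabilityMeasure ν → Literature.Probability.RandomPlanarGeometry.IsSubseqLimitLaw (fun δ (γ : Literature.Probability.RandomPlanarGeometry.SAW.DomainSAW D.carrier δ (a δ) (b δ)) => γ.curve) (fun δ => Literature.Probability.RandomPlanarGeometry.SAW.law D.carrier δ (a δ) (b δ)) ν → (∀ᵐ c ∂ν, Literature.Probability.RandomPlanarGeometry.IsLoewnerDescribable φ c ∧ c.source = D.pt 0) → let W : Literature.Probability.RandomPlanarGeometry.CurveClass ℂ → NNReal → ℝ := fun c => Literature.Probability.RandomPlanarGeometry.drivingFunction φ c; let τ : ℕ → Literature.Probability.RandomPlanarGeometry.CurveClass ℂ → NNReal := fun m c => sInf ({t : NNReal | (m : ℝ) ≤ |W c t|} ∪ {(m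 : NNReal)}); ∀ (m : ℕ) (s t : NNReal), s ≤ t → ∀ (n : ℕ) (S : Fin n → NNReal), (∀ k, S k ≤ s) → ∀ ψ : (Fin n → ℝ) → ℝ, Continuous ψ → (∀ v, |ψ v| ≤ 1) → (∫ c, (W c (min t (τ m c)) - W c (min s (τ m c))) * ψ (fun k => W c (S k)) ∂ν = 0) ∧ (∫ c, ((W c (min t (τ m c))) ^ 2 - (κ : ℝ) * ((min t (τ m c) : NNReal) : ℝ) - ((W c (min s (τ m c))) ^ 2 - (κ : ℝ) * ((min s (τ m c) : NNReal) : ℝ))) * ψ (fun k => W c (S k)) ∂ν = 0)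

/-- item stmt-CriticalPhenomena-16040 · crux · rank 5 · open · by planner
why it might fail: the restriction identity passes to the limit only with null boundary-touching of ν on smooth subdomains and a portmanteau argument on closed range events (cf. AxiomsOfLimit stmt-1370); an approximation-dependent κ would already refute the conjunct as typed.
sources: LawlerSchrammWerner2003Restriction, LawlerSchrammWerner2004SAW, KennedyLawler2013
[crux] (card P3 as a crux: κ is an output, pinned by restriction) for every Dobrushin domain and
endpoint approximation, a probability subsequential limit law ν of the critical SAW curve laws that
is a chordal SLE_κ law in (D; a, b) for some κ > 0 has κ = 8/3 — the lattice-exact two-sided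
restriction identity passes to ν and chordal SLE_κ has the restriction property iff κ = 8/3 (LSW03).
[difficulty: L] -/
@[route_item "route-CriticalPhenomena-SAWTipEnvironment", crux]
def KappaPin : Prop :=
  ∀ (D : Literature.Probability.RandomPlanarGeometry.DobrushinDomain) (a b : ℝ → Literature.Probability.LatticeModels.Site 2), Literature.Probability.RandomPlanarGeometry.SAW.IsEndpointApprox D a b → ∀ ν : MeasureTheory.Measure (Literature.Probability.RandomPlanarGeometry.CurveClass ℂ), MeasureTheory.IsProbabilityMeasure ν → Literature.Probability.RandomPlanarGeometry.IsSubseqLimitLaw (fun δ (γ : Literature.Probability.RandomPlanarGeometry.SAW.DomainSAW D.carrier δ (a δ) (b δ)) => γ.curve) (fun δ => Literature.Probability.RandomPlanarGeometry.SAW.law D.carrier δ (a δ) (b δ)) ν → ∀ κ : NNReal, 0 < κ → Literature.Probability.RandomPlanarGeometry.IsSLELaw κ D ν → κ = 8 / 3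

/-- item stmt-CriticalPhenomena-1881 · crux · rank 6 · open · by planner
why it might fail: no annulus-crossing / Aizenman–Burchard bound for the x_c-SAW is in print (KS17 §4 omits SAW; G2 even fails for UST); sub-ballisticity is the strongest known input; boundary approach of the critical SAW is uncontrolled.
sources: KemppainenSmirnov2017, DuminilCopinHammond2013, arXiv:2310.17299, LawlerSchrammWerner2004SAW
[support] EVENTUAL TIGHTNESS of the critical SAW laws: for every Dobrushin domain and endpoint
approximation, IsTightAlongMesh (fun δ γ => γ.curve) (fun δ => SAW.law D δ a_δ b_δ) — for every ε
some compact set of CurveClass ℂ carries all but ε of the mass for all small δ. This is the form the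
Prokhorov criterion convergesInLawToSLE_of_isTightAlongMesh consumes and the repair of the refuted
all-δ Tight (IsTightLaws over δ ∈ (0,1]) suggested by the refuting theorem; offered to routes
SAWParafermion / SAWConfRestriction as their restated r3/r4. -/
@[route_item "route-CriticalPhenomena-SAWTipEnvironment", crux]
def EventualTight : Prop :=
  ∀ (D : Literature.Probability.RandomPlanarGeometry.DobrushinDomain) (a b : ℝ → Literature.Probability.LatticeModels.Site 2), Literature.Probability.RandomPlanarGeometry.SAW.IsEndpointApprox D a b → Literature.Probability.RandomPlanarGeometry.IsTightAlongMesh (fun δ (γ : Literature.Probability.RandomPlanarGeometry.SAW.DomainSAW D.carrier δ (a δ) (b δ)) => γ.curve) (fun δ => Literature.Probability.RandomPlanarGeometry.SAW.law D.carrier δ (a δ) (b δ))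

/-- item stmt-CriticalPhenomena-16041 · crux · rank 9 · open · by planner
why it might fail: As typed, W_0 = 0 must be DERIVED from source = a and boundary injectivity of φ.boundaryExtension, τ_m shown measurable (hitting time of a closed set by continuous paths) so the Bochner cylinders are not junk, and τ_m ↑ ∞ needs continuity of drivingFunction; a gap makes the hypothesis vacuous.
sources: CDHKSCRAS2014, Lawler2005, KemppainenSmirnov2017
[support] (pure stochastic calculus, provable now from the tree) for κ ∈ (0,4), a chordal
uniformizer φ of (D; a, b) and a probability law ν on curve classes, ν-a.e. Loewner-describable from
a: the cylinder martingale identities of CorrectorPassage for W = drivingFunction φ and W² − κt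
(stopped at τ_m, all m) imply that ν is the chordal SLE_κ law — monotone class ⇒ W^(τ_m), (W² −
κ·)^(τ_m) martingales for the natural filtration; τ_m ↑ ∞ by continuity; W_0 = 0 from source = a;
then isSLELaw_of_isLocalMartingale_driving_of_lt_four (Lévy characterisation,
measurable_drivingFunction_apply, isLoewnerDescribed_drivingFunction). [difficulty: M] -/
@[route_item "route-CriticalPhenomena-SAWTipEnvironment", crux]
def DrivingIdentification : Prop :=
  ∀ (κ : NNReal) (D : Literature.Probability.RandomPlanarGeometry.DobrushinDomain) (φ : Literature.Probability.RandomPlanarGeometry.ConformalEquiv UpperHalfPlane.upperHalfPlaneSet D.carrier) (ν : MeasureTheory.Measure (Literature.Probability.RandomPlanarGeometry.CurveClass ℂ)), 0 < κ → κ < 4 → D.IsChordalUniformizing φ → MeasureTheory.IsProbabilityMeasure ν → (∀ᵐ c ∂ν, Literature.Probability.RandomPlanarGeometry.IsLoewnerDescribable φ c ∧ c.source = D.pt 0) → (let W : Literature.Probability.RandomPlanarGeometry.CurveClass ℂ → NNReal → ℝ := fun c => Literature.Probability.RandomPlanarGeometry.drivingFunction φ c; let τ : ℕ → Literature.Probability.RandomPlanarGeometry.CurveClass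 ℂ → NNReal := fun m c => sInf ({t : NNReal | (m : ℝ) ≤ |W c t|} ∪ {(m : NNReal)}); ∀ (m : ℕ) (s t : NNReal), s ≤ t → ∀ (n : ℕ) (S : Fin n → NNReal), (∀ k, S k ≤ s) → ∀ ψ : (Fin n → ℝ) → ℝ, Continuous ψ → (∀ v, |ψ v| ≤ 1) → (∫ c, (W c (min t (τ m c)) - W c (min s (τ m c))) * ψ (fun k => W c (S k)) ∂ν = 0) ∧ (∫ c, ((W c (min t (τ m c))) ^ 2 - (κ : ℝ) * ((min t (τ m c) : NNReal) : ℝ) - ((W c (min s (τ m c))) ^ 2 - (κ : ℝ) * ((min s (τ m c) : NNReal) : ℝ))) * ψ (fun k => W c (S k)) ∂ν = 0)) → Literature.Probability.RandomPlanarGeometry.IsSLELaw κ D ν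

/-- item stmt-CriticalPhenomena-4481 · crux · rank 9 · open · by planner
why it might fail: Only known engine is KS Condition G2 (uniform unforced-annulus-crossing bound over all conditionings), for which no SAW technology exists (KS17 §4: FK, percolation, HE, LERW; G2 even FAILS for UST, §4.5); limits could have boundary-creeping pieces not generated by a curve.
sources: KemppainenSmirnov2017, DuminilCopinHammond2013, arXiv:2310.17299, LawlerSchrammWerner2004SAW
[crux] (Kemppainen–Smirnov regularity for the SAW) for every Dobrushin domain, endpoint
approximation and chordal uniformizing map φ, every probability subsequential limit law ν of the SAW
curve laws (`IsSubseqLimitLaw`) is carried by curve classes that start at a and are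
Loewner-describable through φ (`IsLoewnerDescribable`: capacity-parametrised pull-back generated by
a curve with continuous driving function) — KS17 Thm 1.5 (ii) / Cor 1.7 in output form, the
hypothesis shape of HarmonicPassage / HarmonicIdentification. [difficulty: open-problem] -/
@[route_item "route-CriticalPhenomena-SAWTipEnvironment", crux]
def LimitsDescribable : Prop :=
  ∀ (D : Literature.Probability.RandomPlanarGeometry.DobrushinDomain) (a b : ℝ → Literature.Probability.LatticeModels.Site 2), Literature.Probability.RandomPlanarGeometry.SAW.IsEndpointApprox D a b → ∀ (φ : Literature.Probability.RandomPlanarGeometry.ConformalEquiv UpperHalfPlane.upperHalfPlaneSet D.carrier), D.IsChordalUniformizing φ → ∀ ν : MeasureTheory.Measure (Literature.Probability.RandomPlanarGeometry.CurveClass ℂ), MeasureTheory.IsProbabilityMeasure ν → Literature.Probability.RandomPlanarGeometry.IsSubseqLimitLaw (fun δ (γ : Literature.Probability.RandomPlanarGeometry.SAW.DomainSAW D.carrier δ (a δ) (b δ)) => γ.curve) (fun δ => Literature.Probability.RandomPlanarGeometry.SAW.law D.carrier δ (a δ) (b δ)) ν → ∀ᵐ c ∂ν, Literature.Probability.RandomPlanarGeometry.IsLoewnerDescribable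 φ c ∧ c.source = D.pt 0

-- item stmt-CriticalPhenomena-16148 · support · rank 9 · open · by planner — informal only, no Lean statement yet:
--   [support] (TB) TIP BALANCE AT A POWER RATE UNDER KESTEN'S MEASURE — the whole-plane engine of
--   MartingaleCorrector (card ergodic-loewner-tip-environment-v2, K1), stated now for visibility and to
--   be typed once definition TipNormalisedUniformizer / loewnerDrift lands; it becomes the rank-2 child
--   of the foreseen split MartingaleCorrector ⇐ TipBalanceRate → ChordalTransfer → MWTransformCLT. Let μ
--   be the two-sided infinite SAW of KestenMeasure, E_k the past seen from the k-th vertex, p(s|E) its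
--   one-step continuation kernel, φ_E the conformal map of ℂ minus the infinite polygonal past onto ℍ
--   with tip

/-- item stmt-CriticalPhenomena-16042 · assembly · rank 1 · open · by planner
sources: KemppainenSmirnov2017, CDHKSCRAS2014, LawlerSchrammWerner2003Restriction
[assembly] MartingaleCorrector → KestenMeasure → CorrectorPassage → DrivingIdentification → KappaPin
→ EventualTight → LimitsDescribable → SAWScalingLimit. -/
@[route_item "route-CriticalPhenomena-SAWTipEnvironment"]
def Assembly : Prop :=
  MartingaleCorrector → KestenMeasure → CorrectorPassage → DrivingIdentification → KappaPin → EventualTight → LimitsDescribable → SAWScalingLimit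

/-! D-0027 §2.1 — DECIDING THEOREM (planner-authored via `route open/edit --closes-file`; by planner-rrepair-CriticalPhenomena-SAWTipEnviro-af148ea1-0 2026-08-16T18:03:58Z):
its hypotheses are this route's items and its conclusion the sub-problem Statement (glue_lint), and it elaborates with this file. -/

@[closes "route-CriticalPhenomena-SAWTipEnvironment"] theorem closes (hMC : MartingaleCorrector) (hKE : KestenMeasure) (hCP : CorrectorPassage)
    (hDI : DrivingIdentification) (hPin : KappaPin) (hT : EventualTight) (hLD : LimitsDescribable) :
    _root_.SAWScalingLimit := by
  classical
  intro D a b hab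
  -- abbreviations: the SAW configuration spaces, the curve observable and the critical laws
  set Ω : ℝ → Type := fun δ => Literature.Probability.RandomPlanarGeometry.SAW.DomainSAW D.carrier δ (a δ) (b δ)
    with hΩ
  set Y : ∀ δ, Ω δ → Literature.Probability.RandomPlanarGeometry.CurveClass ℂ := fun δ γ => γ.curve
    with hYd
  set P : ∀ δ, MeasureTheory.Measure (Ω δ) :=
    fun δ => Literature.Probability.RandomPlanarGeometry.SAW.law D.carrier δ (a δ) (b δ) with hPd
  have hY : ∀ δ, AEMeasurable (Y δ) (P δ) := fun δ =>
    Literature.Probability.RandomPlanarGeometry.SAW.aemeasurable_curve D.carrier δ (a δ) (b δ)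
  -- (1) `0 < x_c`: straight walks give `cₘ ≥ 1`, so `μ = infₘ cₘ^{1/m} ≥ 1` (Madras–Slade (1.2.2))
  have hxc : 0 < Literature.Probability.RandomPlanarGeometry.SAW.criticalFugacity := by
    have key : ∀ (m : ℕ) (x : Literature.Probability.LatticeModels.Site 2),
        ∃ p : (Literature.Probability.LatticeModels.zdGraph 2).Walk x (x + Pi.single 0 (m : ℤ)),
          p.IsPath ∧ p.length = m ∧ ∀ w ∈ p.support, ∃ k : ℕ, w = x + Pi.single 0 (k : ℤ) := by
      intro m
      induction m with
      | zero =>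
        intro x
        refine ⟨SimpleGraph.Walk.nil.copy rfl (by simp), ?_, ?_, ?_⟩
        · rw [SimpleGraph.Walk.isPath_copy]
          exact SimpleGraph.Walk.IsPath.nil
        · rw [SimpleGraph.Walk.length_copy, SimpleGraph.Walk.length_nil]
        · intro w hw
          rw [SimpleGraph.Walk.support_copy, SimpleGraph.Walk.support_nil, List.mem_singleton] at hw
          exact ⟨0, by rw [hw]; simp⟩
      | succ m ih =>
        intro x
        obtain ⟨p, hp, hlen, hsupp⟩ := ih (x + Pi.single 0 (1 : ℤ))
        have hadj : (Literature.Probability.LatticeModels.zdGraph 2).Adj x (x + Pi.single 0 (1 : ℤ)) :=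
          (Literature.Probability.LatticeModels.zdGraph_adj_iff _ _).2 ⟨0, Or.inl rfl⟩
        have heq : x + Pi.single 0 (1 : ℤ) + Pi.single 0 ((m : ℕ) : ℤ) =
            x + Pi.single 0 ((m + 1 : ℕ) : ℤ) := by
          rw [add_assoc, ← Pi.single_add]
          congr 2
          push_cast
          ring
        have hx : x ∉ p.support := by
          intro hx
          obtain ⟨k, hk⟩ := hsupp x hx
          have h0 := congrFun hk 0
          simp only [Pi.add_apply, Pi.single_eq_same] at h0
          omega
        refine ⟨(SimpleGraph.Walk.cons hadj p).copy rfl heq, ?_, ?_, ?_⟩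
        · rw [SimpleGraph.Walk.isPath_copy]
          exact hp.cons hx
        · rw [SimpleGraph.Walk.length_copy, SimpleGraph.Walk.length_cons, hlen]
        · intro w hw
          rw [SimpleGraph.Walk.support_copy, SimpleGraph.Walk.support_cons, List.mem_cons] at hw
          rcases hw with hw | hw
          · exact ⟨0, by rw [hw]; simp⟩
          · obtain ⟨k, hk⟩ := hsupp w hw
            refine ⟨k + 1, ?_⟩
            rw [hk, add_assoc, ← Pi.single_add]
            congr 2
            push_cast
            ring
    have hcount : ∀ m : ℕ, 1 ≤ Literature.Probability.RandomPlanarGeometry.SAW.count m := by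
      intro m
      obtain ⟨p, hp, hlen, -⟩ := key m 0
      have hv : (0 : Literature.Probability.LatticeModels.Site 2) + Pi.single 0 (m : ℤ) ∈
          Literature.Probability.LatticeModels.box 2 m := by
        rw [Literature.Probability.LatticeModels.mem_box]
        intro i
        rw [zero_add]
        rcases eq_or_ne i 0 with rfl | hi
        · simp
        · simp [hi]
      unfold Literature.Probability.RandomPlanarGeometry.SAW.count
      refine le_trans ?_ (Finset.single_le_sum (fun v _ => Nat.zero_le _) hv)
      exact Finset.card_pos.2 ⟨p, Finset.mem_filter.2 ⟨SimpleGraph.mem_finsetWalkLength_iff.2 hlen, hp⟩⟩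
    have hμ : 1 ≤ Literature.Probability.RandomPlanarGeometry.SAW.connectiveConstant :=
      le_ciInf fun n => Real.one_le_rpow (by exact_mod_cast hcount (n + 1)) (by positivity)
    exact inv_pos.2 (one_pos.trans_le hμ)
  -- (2) for small `δ` the SAW law is a probability measure (`a_δ ~ b_δ` joined, `Ω_δ` finite)
  have hprob : ∀ᶠ δ in nhdsWithin (0 : ℝ) (Set.Ioi 0), MeasureTheory.IsProbabilityMeasure (P δ) := by
    filter_upwards [hab.reachable, self_mem_nhdsWithin] with δ hreach hδpos
    have hδ : (0 : ℝ) < δ := hδpos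
    have hfin := Literature.Probability.LatticeModels.meshDomain_finite (Ω := D.carrier) D.isBounded hδ
    haveI hLF : (Literature.Probability.LatticeModels.discreteDomainGraph D.carrier δ).LocallyFinite :=
      fun v => (hfin.subset fun w hw =>
        (Literature.Probability.LatticeModels.discreteDomainGraph_adj_iff.1
          ((SimpleGraph.mem_neighborSet _ _ _).1 hw)).2.2).fintype
    -- every vertex of a walk of `Ω_δ` after the first lies in `Ω_δ`, so a SAW has `≤ |Ω_δ|` steps
    have hsupp : ∀ {u v : Literature.Probability.LatticeModels.Site 2}
        (p : (Literature.Probability.LatticeModels.discreteDomainGraph D.carrier δ).Walk u v),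
        ∀ w ∈ p.support.tail, w ∈ Literature.Probability.LatticeModels.meshDomain D.carrier δ := by
      intro u v p
      induction p with
      | nil => intro w hw; simp at hw
      | cons h q ih =>
        intro w hw
        rw [SimpleGraph.Walk.support_cons, List.tail_cons, SimpleGraph.Walk.mem_support_iff] at hw
        rcases hw with rfl | hw
        · exact (Literature.Probability.LatticeModels.discreteDomainGraph_adj_iff.1 h).2.2
        · exact ih w hw
    have hlen : ∀ {u v : Literature.Probability.LatticeModels.Site 2}
        (p : (Literature.Probability.LatticeModels.discreteDomainGraph D.carrier δ).Walk u v),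
        p.IsPath → p.length < hfin.toFinset.card + 1 := by
      intro u v p hp
      have hnd : p.support.tail.Nodup := List.Nodup.sublist (List.tail_sublist _) hp.support_nodup
      have h1 : p.support.tail.length = p.length := by
        rw [List.length_tail, SimpleGraph.Walk.length_support]
        rfl
      have h2 : p.support.tail.toFinset ⊆ hfin.toFinset := by
        intro w hw
        rw [Set.Finite.mem_toFinset]
        exact hsupp p w (List.mem_toFinset.1 hw)
      have h3 := Finset.card_le_card h2
      rw [List.toFinset_card_of_nodup hnd, h1] at h3
      omega
    haveI hfinite : Finite (Ω δ) := by
      refine Finite.of_injective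
        (β := {p : (Literature.Probability.LatticeModels.discreteDomainGraph D.carrier δ).Walk
          (a δ) (b δ) // p.IsPath ∧ p.length < hfin.toFinset.card + 1})
        (fun γ => ⟨γ.walk, γ.isPath, hlen γ.walk γ.isPath⟩) ?_
      rintro ⟨p, hp⟩ ⟨q, hq⟩ h
      have hpq : p = q := congrArg Subtype.val h
      cases hpq
      rfl
    haveI := Fintype.ofFinite (Ω δ)
    set W := Literature.Probability.RandomPlanarGeometry.SAW.weight D.carrier δ (a δ) (b δ) with hW
    -- total weight: finite …
    have htop : W Set.univ ≠ ⊤ := by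
      rw [hW, Literature.Probability.RandomPlanarGeometry.SAW.weight,
        MeasureTheory.Measure.sum_apply _ MeasurableSet.univ]
      simp only [MeasureTheory.Measure.smul_apply, MeasurableSet.univ, MeasureTheory.Measure.dirac_apply',
        Set.indicator_univ, Pi.one_apply, smul_eq_mul, mul_one, tsum_fintype]
      exact ENNReal.sum_ne_top.2 fun _ _ => ENNReal.ofReal_ne_top
    -- … and positive
    have h0 : W Set.univ ≠ 0 := by
      obtain ⟨p⟩ := hreach
      let γ₀ : Ω δ := ⟨p.bypass, p.bypass_isPath⟩
      have h1 : W {γ₀} ≤ W Set.univ := measure_mono (Set.subset_univ _)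
      rw [hW, Literature.Probability.RandomPlanarGeometry.SAW.weight_singleton] at h1
      exact ((ENNReal.ofReal_pos.2 (pow_pos hxc _)).trans_le h1).ne'
    constructor
    rw [hPd]
    beta_reduce
    rw [Literature.Probability.RandomPlanarGeometry.SAW.law, MeasureTheory.Measure.smul_apply,
      smul_eq_mul, ENNReal.inv_mul_cancel h0 htop]
  -- (3) Prokhorov criterion (Billingsley 5.1 Cor., `convergesInLawToSLE_of_isTightAlongMesh'`) for a
  -- surrogate family of probability laws equal to the push-forward laws for small `δ`; the
  -- subsequential limits are identified by THE THESIS: uniformizer, LimitsDescribable,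
  -- MartingaleCorrector over KestenMeasure, CorrectorPassage, DrivingIdentification (Lévy), KappaPin
  obtain ⟨ν, hν⟩ : ∃ ν : ℝ → MeasureTheory.Measure (Literature.Probability.RandomPlanarGeometry.CurveClass ℂ),
      ∀ δ, ν δ = if MeasureTheory.IsProbabilityMeasure ((P δ).map (Y δ)) then (P δ).map (Y δ)
        else MeasureTheory.Measure.dirac (Literature.Probability.RandomPlanarGeometry.CurveClass.mk
          (Literature.Probability.RandomPlanarGeometry.Curve.const 0)) :=
    ⟨_, fun _ => rfl⟩
  have hνprob : ∀ δ, MeasureTheory.IsProbabilityMeasure (ν δ) := by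
    intro δ
    by_cases h : MeasureTheory.IsProbabilityMeasure ((P δ).map (Y δ))
    · rw [hν δ, if_pos h]
      exact h
    · rw [hν δ, if_neg h]
      infer_instance
  have hev : ∀ᶠ δ in nhdsWithin (0 : ℝ) (Set.Ioi 0), ν δ = (P δ).map (Y δ) := by
    filter_upwards [hprob] with δ hPδ
    haveI := hPδ
    rw [hν δ, if_pos (MeasureTheory.Measure.isProbabilityMeasure_map (hY δ))]
  have key : Literature.Probability.RandomPlanarGeometry.ConvergesInLawToSLE ((8 : NNReal) / 3) D
      (Ωδ := fun _ : ℝ => Literature.Probability.RandomPlanarGeometry.CurveClass ℂ)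
      (fun (_ : ℝ) (x : Literature.Probability.RandomPlanarGeometry.CurveClass ℂ) => x) ν := by
    haveI : ∀ δ, MeasureTheory.IsProbabilityMeasure (ν δ) := hνprob
    refine Literature.Probability.RandomPlanarGeometry.convergesInLawToSLE_of_isTightAlongMesh'
      (Filter.Eventually.of_forall fun δ => aemeasurable_id') ?_ ?_
    · -- tightness (EventualTight) transfers along the germ
      intro ε hε
      obtain ⟨K, hK, hb⟩ := hT D a b hab ε hε
      refine ⟨K, hK, ?_⟩
      filter_upwards [hb, hev] with δ hδ hδ'
      have hpre : (fun x : Literature.Probability.RandomPlanarGeometry.CurveClass ℂ => x) ⁻¹' Kᶜ = Kᶜ :=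
        rfl
      rw [hpre, hδ',
        MeasureTheory.Measure.map_apply_of_aemeasurable (hY δ) hK.isClosed.isOpen_compl.measurableSet]
      exact hδ
    · -- identification of the subsequential limit laws
      rintro μ hμ ⟨s, hs, hlim⟩
      have hsub : Literature.Probability.RandomPlanarGeometry.IsSubseqLimitLaw Y P μ := by
        refine ⟨s, hs, fun f => (hlim f).congr' ?_⟩
        filter_upwards [hs.eventually hev] with n hn
        beta_reduce
        rw [hn, MeasureTheory.integral_map (hY (s n)) f.continuous.aestronglyMeasurable]
      obtain ⟨κ, hκ0, hκ4, hcorr⟩ := hMC hKE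
      obtain ⟨φ, hφ⟩ :=
        Literature.Probability.RandomPlanarGeometry.MarkedDomain.exists_isChordalUniformizing_holds D
      have hdesc := hLD D a b hab φ hφ μ hμ hsub
      have hcyl := hCP κ D a b φ hκ0 hab hφ (hcorr D a b hab φ hφ) μ hμ hsub hdesc
      have hSLE : Literature.Probability.RandomPlanarGeometry.IsSLELaw κ D μ :=
        hDI κ D φ μ hκ0 hκ4 hφ hμ hdesc hcyl
      have hk : κ = 8 / 3 := hPin D a b hab μ hμ hsub κ hκ0 hSLE
      rw [hk] at hSLE
      exact hSLE
  obtain ⟨Γ, hΓ, -, hlaw⟩ := key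
  refine ⟨Γ, hΓ, Filter.Eventually.of_forall hY, fun f => (hlaw f).congr' ?_⟩
  filter_upwards [hev] with δ hδ
  beta_reduce
  rw [hδ, MeasureTheory.integral_map (hY δ) f.continuous.aestronglyMeasurable]

end Summit.CriticalPhenomena.SAWScalingLimit.Theses.SAWTipEnvironment
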